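import Summits.BirchSwinnertonDyer.BirchSwinnertonDyer.Theorems.ClassRecordThreeCartanSupplySphericalLeaves
import Summits.BirchSwinnertonDyer.BirchSwinnertonDyer.Theorems.ClassRecordThreeEulerHalvesAtThreeCartanTransportSplitTransport
import HarnessLib

/-!
# (MO1) `SplitLevelMultiplicityOne` is a consequence of the named print fact (MO1ᴾ) `cartanLevel_eigenMultiplicityOne`

Helper file for item stmt-BirchSwinnertonDyer-24801 `CartanOnePlaceDegreeLawAtThree` of route `ClassRecordThree` (twin `KolyvaginRoadThree`),
leaf (MO1) `CartanDoubleCoset.SplitLevelMultiplicityOne` of the `doublecoset` ∕ `jacquet` certificates (registry rev 9, stub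
`stub_splitLevelMultiplicityOne`; cell bsd-stepL, SUMMON key `mo1close`, director-bsd (760) (α)/(M2)).

## Content

* §1 **Congruence of the Hecke operators of an order under equality of images** (PROVED, definitional bookkeeping): the weight-two
  Hecke operator `unitsHeckeFun ι hO n` of the norm-one group `ι(O¹)` of an order `O ⊆ B` depends on `(B, ι, O)` ONLY through the
  matrix image `ι(O) ⊆ M₂(ℝ)` — indeed only through the set `ι(O(n)) ⊆ GL₂(ℝ)` (`unitsHeckeSet`) and the group `ι(O¹) ≤ GL₂(ℝ)`
  (`normOneUnits`), of which it is a function (`unitsHeckeFun_eq_of_image_eq`; no slash-invariance of the argument is needed: equal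
  sets and equal groups give literally the same quotient, the same representatives and the same sum). Lemmas
  `unitsHeckeSet_eq_of_image_eq`, `normOneUnits_eq_of_image_eq`, `unitsHeckeFun_eq_of_image_eq`, and the unfolding
  `heckeFun_eq_unitsHeckeFun` (`X.heckeFun n = unitsHeckeFun X.ι X.isOrder n`, `rfl`).
* §2 **(MO1ᴾ) ⇒ (MO1)** (`splitLevelMultiplicityOne_of_pure`). (MO1) speaks of cusp forms on the split-Cartan level
  `Γ_{T_s} = R.levelOf T_s` of the cover of a Cartan datum `X` at `q ∈ C` and of the Hecke operators `unitsHeckeFun X.ι hOs ℓ` of a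
  split sub-order `Os ⊆ X.B` pinned by its image `ι(Os) = ι{y ∈ O₀' : R.red y diagonal}`. The tree's transport brick
  `CartanTransport.Split.exists_splitDatum` hands over the split sheet as a PURE Cartan datum `Xs : CartanLevelCurveData D (M q²) (C∖q)`
  with `Xs.Gamma = R.levelOf T_s` (equality of subgroups of `GL₂(ℝ)`) and `ι_s(Xs.O)` = the same image; so `S₂(Γ_{T_s}) = S₂(Xs.Gamma)`
  (`exists_cuspForm_coe_eq_of_level_eq`, same functions on `ℍ`), `unitsHeckeFun X.ι hOs ℓ = Xs.heckeFun ℓ` (§1), and (MO1) is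
  LITERALLY the instance `Xs` of (MO1ᴾ) in its split-sheet currency `cartanLevel_eigenMultiplicityOne.of_erase` (good set
  `ℓ ∤ q·(D·M·∏_C p)`, conductor budget `D·M·∏_C p² = N`; both already absorbed there).

## Honest status

`splitLevelMultiplicityOne_of_pure` is CONDITIONAL on the named Literature fact (MO1ᴾ)
`Literature.NumberTheory.Automorphic.cartanLevel_eigenMultiplicityOne` (accepted p813509; print status in its docstring: `D = 1`, odd
Cartan primes IN PRINT — Kohen–Pacetti 2016 Thm. 2.1 + Diamond–Shurman Thm. 5.8.2; `D > 1` PRINT-COMPOSITE — Yuan–Zhang–Zhang §3.1.5,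
Gelbart Thm. 5.14 ∕ 10.5 ∕ 10.10, Casselman, Tunnell–Saito). It makes the registered stub (MO1) a ONE-LINE consequence of a named print
fact; it does NOT prove the (unconditional) stub `stub_splitLevelMultiplicityOne` by signature, the registry
`Cruxes/CartanOnePlaceDegreeLawAtThree/Lines/jacquet.lean` rev 9 is untouched, no count moves, and nothing about NUM ∕ 24801 ∕ 19109 is
proved for any curve. Typed ∕ reduced ≠ proved; BSD is proved for no curve.
[cite: KohenPacetti2016, §2 Thm. 2.1 (arXiv:1403.7801v3 p. 12)] [cite: ShimuraIATAF1971, §3.3 and §8.3 (8.3.4) p. 238]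
-/

set_option linter.dupNamespace false  -- `Summit.BirchSwinnertonDyer.BirchSwinnertonDyer.…` (summit = problem), as every file of this directory
set_option autoImplicit false

noncomputable section

open scoped MatrixGroups ModularForm
open UpperHalfPlane hiding I

namespace Summit.BirchSwinnertonDyer.BirchSwinnertonDyer.Theorems.CartanDoubleCoset

open Literature.NumberTheory.Automorphic
open Summit.BirchSwinnertonDyer.BirchSwinnertonDyer.Theorems.CartanCover

/-! ## §1 The Hecke operators of an order are a function of the image `ι(O)` -/

section ImageCongruence

variable {B₁ : Type*} [Ring B₁] [Algebra ℚ B₁] {B₂ : Type*} [Ring B₂] [Algebra ℚ B₂]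
  (ι₁ : B₁ →ₐ[ℚ] Matrix (Fin 2) (Fin 2) ℝ) {O₁ : Submodule ℤ B₁}
  (ι₂ : B₂ →ₐ[ℚ] Matrix (Fin 2) (Fin 2) ℝ) {O₂ : Submodule ℤ B₂}

/-- **Equal images ⇒ equal norm-`n` sets `ι(O(n))`.** If two orders `O₁ ⊆ B₁`, `O₂ ⊆ B₂` have the same matrix image
`ι₁(O₁) = ι₂(O₂) ⊆ M₂(ℝ)`, then `ι₁(O₁(n)) = ι₂(O₂(n))` in `GL₂(ℝ)` for every `n` (the set is cut out of the image by `det = n`).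
[cite: ShimuraIATAF1971, §3.3] -/
theorem unitsHeckeSet_eq_of_image_eq
    (himg : ∀ m : Matrix (Fin 2) (Fin 2) ℝ, (∃ x ∈ O₁, ι₁ x = m) ↔ ∃ y ∈ O₂, ι₂ y = m) (n : ℕ) :
    unitsHeckeSet ι₁ (O := O₁) n = unitsHeckeSet ι₂ (O := O₂) n :=
  Set.ext fun _ => and_congr_left' (himg _)

variable (hO₁ : Brandt.IsOrder B₁ O₁) (hO₂ : Brandt.IsOrder B₂ O₂)

/-- **Equal images ⇒ equal norm-one groups `ι(O¹)`.** If `ι₁(O₁) = ι₂(O₂) ⊆ M₂(ℝ)`, then `ι₁(O₁¹) = ι₂(O₂¹) ≤ GL₂(ℝ)`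
(the group is cut out of the image by `g, g⁻¹ ∈ ι(O)`, `det g = 1`). [cite: VignerasLNM800, Ch. IV §1] -/
theorem normOneUnits_eq_of_image_eq
    (himg : ∀ m : Matrix (Fin 2) (Fin 2) ℝ, (∃ x ∈ O₁, ι₁ x = m) ↔ ∃ y ∈ O₂, ι₂ y = m) :
    normOneUnits ι₁ hO₁ = normOneUnits ι₂ hO₂ :=
  Subgroup.ext fun _ => by rw [mem_normOneUnits_iff, mem_normOneUnits_iff, himg, himg]

/-- **CONGRUENCE OF HECKE OPERATORS UNDER EQUALITY OF IMAGES.** The weight-two Hecke operator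
`T_n = unitsHeckeFun ι hO n = Σ_{ι(O¹)∖ι(O(n))} · ∣[2] g` of an order depends on `(B, ι, O)` only through the set `ι(O(n)) ⊆ GL₂(ℝ)` and the
group `ι(O¹) ≤ GL₂(ℝ)`: it is the value at `(ι(O(n)), ι(O¹))` of ONE function of a set `S` and a subgroup `Γ` (the sum over
`Quotient.out`-representatives of the `Γ`-left-cosets in `S`; definitionally, by proof-irrelevance of the setoid axioms). Hence two orders
with the same image `ι₁(O₁) = ι₂(O₂)` — in particular two presentations of the same split-Cartan order inside different ambient data —
have the SAME Hecke operators on ALL functions `h : ℍ → ℂ` (no invariance of `h` is needed). Reusable by the 24801 lineage wherever an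
order is re-packaged as a datum. [cite: ShimuraIATAF1971, §8.3 (8.3.4) p. 238] -/
theorem unitsHeckeFun_eq_of_image_eq
    (himg : ∀ m : Matrix (Fin 2) (Fin 2) ℝ, (∃ x ∈ O₁, ι₁ x = m) ↔ ∃ y ∈ O₂, ι₂ y = m) (n : ℕ) (h : ℍ → ℂ) :
    unitsHeckeFun ι₁ hO₁ n h = unitsHeckeFun ι₂ hO₂ n h := by
  -- the operator as ONE function `Φ` of a set `S ⊆ GL₂(ℝ)` and a subgroup `Γ ≤ GL₂(ℝ)` (body verbatim `unitsHeckeSetoid` ∕ `unitsHeckeFun`)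
  let Φ : (S : Set (GL (Fin 2) ℝ)) → Subgroup (GL (Fin 2) ℝ) → (ℍ → ℂ) := fun S Γ τ =>
    ∑ᶠ c : Quotient (⟨fun a a' : S => ∃ γ ∈ Γ, γ * (a : GL (Fin 2) ℝ) = a',
      ⟨fun a => ⟨1, one_mem _, one_mul _⟩,
       fun {a a'} hr => hr.elim fun γ hγ => ⟨γ⁻¹, inv_mem hγ.1, by rw [← hγ.2, inv_mul_cancel_left]⟩,
       fun {a a' a''} hr hr' => hr.elim fun γ hγ => hr'.elim fun γ' hγ' =>
         ⟨γ' * γ, mul_mem hγ'.1 hγ.1, by rw [mul_assoc, hγ.2, hγ'.2]⟩⟩⟩ : Setoid S),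
      (h ∣[(2 : ℤ)] ((c.out : S) : GL (Fin 2) ℝ)) τ
  have h₁ : unitsHeckeFun ι₁ hO₁ n h = Φ (unitsHeckeSet ι₁ (O := O₁) n) (normOneUnits ι₁ hO₁) := rfl
  have h₂ : unitsHeckeFun ι₂ hO₂ n h = Φ (unitsHeckeSet ι₂ (O := O₂) n) (normOneUnits ι₂ hO₂) := rfl
  rw [h₁, h₂, unitsHeckeSet_eq_of_image_eq ι₁ ι₂ himg n, normOneUnits_eq_of_image_eq ι₁ ι₂ hO₁ hO₂ himg]

end ImageCongruence

/-- The Hecke operator `T_n` of a Cartan datum IS the order-parametrised operator at its own order and splitting (same set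
`ι(O(n))` — `unitsHeckeSet_eq_heckeSet` —, same group `X.Gamma = ι(O¹)`, same sum; definitional). [cite: KohenPacetti2016, §1.3 and §2] -/
theorem heckeFun_eq_unitsHeckeFun {D M : ℕ} {C : Finset ℕ} (X : CartanLevelCurveData D M C) (n : ℕ) (h : ℍ → ℂ) :
    X.heckeFun n h = unitsHeckeFun X.ι X.isOrder n h :=
  rfl

/-! ## §2 (MO1ᴾ) ⇒ (MO1) -/

/-- **(MO1) FROM THE NAMED PRINT FACT (MO1ᴾ).** `cartanLevel_eigenMultiplicityOne → SplitLevelMultiplicityOne`.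
PROOF. Given the data of (MO1) — `V` of conductor `N = D·M·∏_C p²`, `X : CartanLevelCurveData D M C`, `q ∈ C`, a cover reduction `R`,
a split sub-order `Os` with `ι(Os) = ι{y ∈ O₀' : R.red y diagonal}`, and two `a_ℓ(V)`-eigenforms `F₁ ≠ 0`, `F₂` on `Γ_{T_s} = R.levelOf T_s`
for the operators `unitsHeckeFun X.ι hOs ℓ`, `ℓ ∤ q·D·M·∏_C p` —: (i) `CartanTransport.Split.exists_splitDatum` (with `T_s` = the diagonal
torus, `mem_splitTorus_iff`) gives a pure datum `Xs : CartanLevelCurveData D (M q²) (C∖q)` with `Xs.Gamma = R.levelOf T_s` and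
`ι_s(Xs.O) = ι{y ∈ O₀' : R.red y diagonal} = ι(Os)`; (ii) by §1, `unitsHeckeFun X.ι hOs ℓ = Xs.heckeFun ℓ` on all functions; (iii) `F₁, F₂`
ARE cusp forms on `Xs.Gamma` with the same underlying functions (`exists_cuspForm_coe_eq_of_level_eq`), still eigen and the first still
non-zero; (iv) (MO1ᴾ) in its split-sheet currency, `cartanLevel_eigenMultiplicityOne.of_erase` at `Xs`, gives `F₂ = c·F₁` as functions.
CONDITIONAL on (MO1ᴾ) (named Literature fact, p813509); proves nothing unconditionally about the stub (MO1), NUM, 24801 or 19109.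
[cite: KohenPacetti2016, §2 Thm. 2.1 (arXiv:1403.7801v3 p. 12)] [cite: DiamondShurman2005, Thm. 5.8.2(b)] -/
theorem splitLevelMultiplicityOne_of_pure (h : Literature.NumberTheory.Automorphic.cartanLevel_eigenMultiplicityOne) :
    SplitLevelMultiplicityOne := by
  intro V _ N D M C q _ X hq R hN hDMC Os hOs himg F₁ F₂ h₁ h₂ hF₁
  -- (i) the split sheet as a PURE datum `Xs` of level `(D, M q²; C∖q)` with `Xs.Gamma = Γ_{T_s}` and the image of its order
  obtain ⟨Xs, hXsΓ, himgXs⟩ := CartanTransport.Split.exists_splitDatum X hq R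
    (CartanTorusCubeCut.torusSubgroup (splitGen q)) fun t => (mem_splitTorus_iff t).trans and_comm
  -- the two split orders `Os ⊆ X.B` and `Xs.O ⊆ Xs.B` have the same matrix image
  have hOO : ∀ m : Matrix (Fin 2) (Fin 2) ℝ, (∃ x ∈ Os, X.ι x = m) ↔ ∃ y ∈ Xs.O, Xs.ι y = m := by
    intro m
    rw [himg, himgXs]
    constructor
    · rintro ⟨y, h01, h10, hm⟩
      exact ⟨y, ⟨y.2, h10, h01⟩, hm⟩
    · rintro ⟨y, ⟨hy, h10, h01⟩, hm⟩
      exact ⟨⟨y, hy⟩, h01, h10, hm⟩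
  -- (ii) hence the same Hecke operators
  have hT : ∀ (ℓ : ℕ) (f : ℍ → ℂ), unitsHeckeFun X.ι hOs ℓ f = Xs.heckeFun ℓ f := fun ℓ f =>
    (unitsHeckeFun_eq_of_image_eq X.ι Xs.ι hOs Xs.isOrder hOO ℓ f).trans (heckeFun_eq_unitsHeckeFun Xs ℓ f).symm
  -- (iii) the forms are forms on `Xs.Gamma`, with the same underlying functions
  obtain ⟨G₁, hG₁⟩ := exists_cuspForm_coe_eq_of_level_eq hXsΓ.symm F₁
  obtain ⟨G₂, hG₂⟩ := exists_cuspForm_coe_eq_of_level_eq hXsΓ.symm F₂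
  have hG₁ne : G₁ ≠ 0 := fun h0 =>
    hF₁ (DFunLike.ext' (by rw [← hG₁, h0, CuspForm.coe_zero, CuspForm.coe_zero]))
  -- (iv) (MO1ᴾ) at `Xs`, in the split-sheet currency
  obtain ⟨c, hc⟩ := h.of_erase V N D M C q hq Xs hN hDMC G₁ G₂
    (fun ℓ hℓ hℓN => by rw [← hT, hG₁]; exact h₁ ℓ hℓ hℓN)
    (fun ℓ hℓ hℓN => by rw [← hT, hG₂]; exact h₂ ℓ hℓ hℓN) hG₁ne
  exact ⟨c, by rw [← hG₂, hc, hG₁]⟩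

end Summit.BirchSwinnertonDyer.BirchSwinnertonDyer.Theorems.CartanDoubleCoset

end
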